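import Summits.AtomisticToContinuum.HydrodynamicLimit.Theorems.RelayRaceLocalityNearConstantShortTimeHLGoodEventPackage
import Summits.AtomisticToContinuum.HydrodynamicLimit.Theorems.RelayRaceLocalityNearConstantShortTimeHLEntropyPricePackage
import Summits.AtomisticToContinuum.HydrodynamicLimit.Theorems.RelayRaceLocalityNearConstantShortTimeHLGronwallCells
import Summits.AtomisticToContinuum.HydrodynamicLimit.Theorems.RelayRaceLocalityNearConstantShortTimeHLLogProfileObsBounds
import Summits.AtomisticToContinuum.HydrodynamicLimit.Theorems.RelayRaceLocalityNearConstantShortTimeHLFluctuationTools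
import Summits.AtomisticToContinuum.HydrodynamicLimit.Theorems.RelayRaceLocalityNearConstantShortTimeHLGaussianTail
import Summits.AtomisticToContinuum.HydrodynamicLimit.Theorems.RelayRaceLocalityNearConstantShortTimeHLMomentPackage
import Summits.AtomisticToContinuum.HydrodynamicLimit.Theorems.RelayRaceLocalityNearConstantShortTimeHLGridIncrements
import Summits.AtomisticToContinuum.HydrodynamicLimit.Theorems.RelayRaceLocalityNearConstantShortTimeHLGridCells
import Summits.AtomisticToContinuum.HydrodynamicLimit.Theorems.RelayRaceLocalityNearConstantShortTimeHLDynLimits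
import Summits.AtomisticToContinuum.HydrodynamicLimit.Theorems.RelayRaceLocalityNearConstantShortTimeHLDynamicDefs
import Literature.Analysis.FluidPDE.CollisionalTransferMeasurable
import HarnessLib

/-!
# Crux `NearConstantShortTimeHL` (stmt-AtomisticToContinuum-12502), line `small-tilt-domination` — registered skeleton stub
`stub_dynamic : DynamicTheorem` (level 1 of the Grönwall assembly: Yau's relative-entropy Grönwall at fixed data)

Assembly of the six packages of the line (`good_event_package`, `moment_package`, `entropy_price_package`, `grid_increments`, `grid_cells`,
`gronwall_cells`): for the defect `D_N(r) = H(r) − E_{P_N}[logProfileObs_r ∘ Φ_r]` of the mean of the log-profile observable from its Euler value,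
the good events (caps and closure defects on a diagonal grid `ι_N → ∞`), the kinetic-moment bookkeeping, the entropy price of the mesoscale
fluctuation (`∫ fluctuationE ≤ γ⁻¹(D_N + κ₁)`, St2′) and the window / cell integral inequalities feed the discrete Grönwall
`D_N(t) ≤ (A_N + β′E_N) e^{β′t}`, `β′ = C(1+L)γ⁻¹`; choosing the cubic-tail level `L` first (the Gaussian factor `e^{−aL²}` beats `e^{β′t}`,
`dyn_exists_level`), then `κ₁`, the truncation `M′` of the bad-set charge, and finally `N` (`ι_N → ∞`, `P_N(G′ᶜ) → 0`, `D_N(0) → 0` by the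
tie) gives `D_N(t) ≤ κ` eventually — the conclusion of `DynamicTheorem`. The case `t = 0` is the tie itself (`Φ_0 = id` on the good set).

References: H.-T. Yau, Lett. Math. Phys. 22 (1991) §2.
-/

noncomputable section

namespace Summit.AtomisticToContinuum.HydrodynamicLimit.Theorems.NearConstantShortTimeHL

open scoped BigOperators ENNReal
open MeasureTheory Set Filter Topology
open Literature.MathematicalPhysics.KineticTheory Literature.Analysis.FluidPDE Literature.Analysis.FunctionSpaces

/-! ## The assembly -/

/-- **Registered skeleton stub `stub_dynamic : DynamicTheorem`** (level 1 of the Grönwall assembly of the line `small-tilt-domination`): Yau's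
relative-entropy Grönwall at fixed data, assembled from the six landed packages and pushed to the limit (`L`, then `κ₁`, `M′`, `N`).
[cite: Yau1991, §2] -/
theorem stub_dynamic : DynamicTheorem := by
  intro η₀ F hη₀ hFa hEq σ T hσ ρ θ u hE t ht ht1 hband hmass ηP hηP hηP₀ ε n hn hε Φ P hPdef hP π₀ πst hπ₀ hπ hm₀ hm₀i hiso
    γ hγ hSt2 hcapV hcapP a A ha hA hgauss G aI c₀ haI hImp η₂ η₃ hη₂ hη₃ hKmom hKen κ hκ
  -- notation: the Euler entropy functional `H` and the defect `D`
  set H : ℝ → ℝ := fun r => ∫ x, ρ r x * (Real.log (ρ r x) + gChem σ (ρ r x) - 3 / 2 * Real.log (2 * Real.pi * θ r x) - 3 / 2)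
    with hH_def
  have hT0 : 0 < T := lt_of_le_of_lt ht.1 ht.2
  have hac : ∀ N, P N ≪ liouville (Torus.geometry (Fin 3)) (n N) (ε N) := fun N => by
    rw [hPdef N]; exact withDensity_absolutelyContinuous _ _
  have hgoodae : ∀ N, ∀ᵐ z ∂P N, z ∈ (Φ N).good := fun N =>
    (HardSphereFlow.measure_compl_good_of_absolutelyContinuous (Φ N) (hac N) : P N (Φ N).goodᶜ = 0)
  -- the entropy price (also gives the integrability clause)
  have hepp := entropy_price_package hη₀ hFa hEq hσ hE ht hband hn hε Φ P hPdef hP hπ₀ hπ hm₀ hm₀i hiso hγ hSt2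
  ------------------------------------------------------------------
  -- Case `t = 0`
  ------------------------------------------------------------------
  rcases ht.1.eq_or_lt with ht0 | ht0
  · subst ht0
    have h1 := hepp κ hκ
    have h2 : ∀ᶠ N : ℕ in atTop, H 0 - κ ≤ ∫ z, logProfileObs σ ρ θ u 0 z ∂P N := by
      have := hm₀.eventually (eventually_gt_nhds (show H 0 - κ < H 0 by linarith))
      exact this.mono fun N h => h.le
    filter_upwards [h1, h2] with N h1 h2
    have h0 : (0 : ℝ) ∈ Set.Icc (0 : ℝ) 0 := ⟨le_rfl, le_rfl⟩
    refine ⟨(h1 0 h0).1, ?_⟩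
    have e : ∫ z, logProfileObs σ ρ θ u 0 ((Φ N).flow 0 z) ∂P N = ∫ z, logProfileObs σ ρ θ u 0 z ∂P N :=
      integral_congr_ae ((hgoodae N).mono fun z hz => by simp only [(Φ N).flow_zero z hz])
    rw [e]; exact h2
  ------------------------------------------------------------------
  -- Case `0 < t`: the packages
  ------------------------------------------------------------------
  obtain ⟨Λ, hΛ, ι, hι, G', hG'm, hG'c, hgood⟩ := good_event_package hη₀ hFa hEq hσ hE ht ht0 ht1 hband hn Φ P G haI hImp hη₂ hη₃
    hKmom hKen hcapV hcapP
  obtain ⟨CK, hCK, C3, hC3, hmomN, hcubic, htail⟩ := moment_package hE hT0 Φ P hPdef hP ha hA hgauss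
  obtain ⟨CX, hCX, hCXb⟩ := abs_logProfileObs_le hη₀ hFa hEq hσ hE ht hband
  obtain ⟨Cgi, hCgi, hgi⟩ := grid_increments hη₀ hFa hEq hσ hE ht ht0 hband hηP hηP₀
  obtain ⟨Cgc, hCgc, hgc⟩ := grid_cells hη₀ hFa hEq hσ hE ht ht0 hband hηP hηP₀
  ------------------------------------------------------------------
  -- constants: `β = γ⁻¹`, the cubic level `L`, `β'`, `Tl`, `κ₁`, `M'`
  ------------------------------------------------------------------
  set β : ℝ := γ⁻¹ with hβ_def
  have hβ0 : 0 < β := inv_pos.2 hγ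
  obtain ⟨L, hLmin, hL1, hLsmall⟩ := dyn_exists_level ha (Cgi * β * t) 0 (Cgi * t * A) (max 1 (Real.sqrt (3 / (2 * a)))) (κ / 8)
    (by positivity) (by positivity)
  set β' : ℝ := Cgi * (1 + L) * β with hβ'_def
  have hβ'0 : 0 ≤ β' := by positivity
  set Tl : ℝ := L ^ 3 * Real.exp (-(a * L ^ 2)) * A with hTl_def
  have hTl0 : 0 ≤ Tl := by positivity
  set X : ℝ := Real.exp (β' * t) with hX_def
  have hX1 : 1 ≤ X := Real.one_le_exp (by positivity)
  have hX0 : 0 < X := by positivity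
  have hLsmall' : Cgi * t * Tl * X ≤ κ / 8 := by
    have e : Cgi * t * Tl * X = Cgi * t * A * L ^ 3 * Real.exp (-(a * L ^ 2)) * Real.exp (Cgi * β * t * (1 + L) + 0) := by
      rw [hTl_def, hX_def, hβ'_def, add_zero]; ring_nf
    rw [e]; exact hLsmall
  set κ₁ : ℝ := κ / (8 * (Cgi * (1 + L) * β * t * X + 1)) with hκ₁_def
  have hκ₁0 : 0 < κ₁ := by positivity
  have hκ₁small : Cgi * (1 + L) * β * κ₁ * t * X ≤ κ / 8 := by
    have hden : 0 < Cgi * (1 + L) * β * t * X + 1 := by positivity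
    have e : Cgi * (1 + L) * β * κ₁ * t * X = (κ / 8) * ((Cgi * (1 + L) * β * t * X) / (Cgi * (1 + L) * β * t * X + 1)) := by
      rw [hκ₁_def]; field_simp
    rw [e]
    have : (Cgi * (1 + L) * β * t * X) / (Cgi * (1 + L) * β * t * X + 1) ≤ 1 := by
      rw [div_le_one hden]; linarith
    calc (κ / 8) * ((Cgi * (1 + L) * β * t * X) / (Cgi * (1 + L) * β * t * X + 1)) ≤ (κ / 8) * 1 :=
          mul_le_mul_of_nonneg_left this (by positivity)
      _ = κ / 8 := mul_one _
  set cG : ℝ := 2 * CX * (1 + β' * t) * X with hcG_def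
  have hcG0 : 0 < cG := by positivity
  set M' : ℝ := 8 * cG * CK / κ + 1 with hM'_def
  have hM'0 : 0 < M' := by positivity
  have hM'small : cG * (CK / M') ≤ κ / 8 := by
    rw [mul_div_assoc', div_le_iff₀ hM'0, hM'_def]
    have : κ / 8 * (8 * cG * CK / κ + 1) = cG * CK + κ / 8 := by field_simp
    rw [this]; linarith
  ------------------------------------------------------------------
  -- the vanishing remainder
  ------------------------------------------------------------------
  set pG : ℕ → ℝ := fun N => (P N (G' N)ᶜ).toReal with hpG_def
  have hpG : Tendsto pG atTop (𝓝 0) := by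
    have := (ENNReal.tendsto_toReal ENNReal.zero_ne_top).comp hG'c
    rw [ENNReal.toReal_zero] at this
    exact this
  set dd : ℕ → ℝ := fun N => 2 * Λ / ((ι N : ℝ) + 1) ^ 2 with hdd_def
  obtain ⟨hdd, hιdd⟩ := dyn_tendsto_defect hι (2 * Λ)
  have hω := dyn_tendsto_inv_succ hι
  have hτ := dyn_tendsto_const_div hι t
  set D0 : ℕ → ℝ := fun N => max 0 (H 0 - ∫ z, logProfileObs σ ρ θ u 0 ((Φ N).flow 0 z) ∂P N) with hD0_def
  have hD0 : Tendsto D0 atTop (𝓝 0) := by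
    have h1 : Tendsto (fun N => H 0 - ∫ z, logProfileObs σ ρ θ u 0 ((Φ N).flow 0 z) ∂P N) atTop (𝓝 (H 0 - H 0)) := by
      refine tendsto_const_nhds.sub (hm₀.congr fun N => ?_)
      exact (integral_congr_ae ((hgoodae N).mono fun z hz => by simp only [(Φ N).flow_zero z hz])).symm
    rw [sub_self] at h1
    have := h1.max (tendsto_const_nhds (x := (0 : ℝ)))
    rw [max_self] at this
    exact this.congr fun N => max_comm _ _
  set R : ℕ → ℝ := fun N => X * (D0 N + 2 * dd N + 6 * t * ((ι N : ℝ) + 1)⁻¹ * (1 + CK) + Cgi * t * pG N +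
      2 * CX * (1 + β' * t) * ((1 + M') * pG N) +
      β' * (Cgc * t * (t / ι N) + 2 * ((ι N : ℝ) * dd N) + Cgc * t * ((t / ι N) * (1 + CK) + (t / ι N) * C3))) with hR_def
  have hR : Tendsto R atTop (𝓝 0) := by
    have h : Tendsto (fun N => X * (D0 N + 2 * dd N + 6 * t * ((ι N : ℝ) + 1)⁻¹ * (1 + CK) + Cgi * t * pG N +
        2 * CX * (1 + β' * t) * ((1 + M') * pG N) +
        β' * (Cgc * t * (t / ι N) + 2 * ((ι N : ℝ) * dd N) + Cgc * t * ((t / ι N) * (1 + CK) + (t / ι N) * C3))))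
        atTop (𝓝 (X * (0 + 2 * 0 + 6 * t * 0 * (1 + CK) + Cgi * t * 0 + 2 * CX * (1 + β' * t) * ((1 + M') * 0) +
          β' * (Cgc * t * 0 + 2 * 0 + Cgc * t * (0 * (1 + CK) + 0 * C3))))) := by
      refine Tendsto.const_mul X ?_
      refine ((((hD0.add (hdd.const_mul 2)).add ((hω.const_mul (6 * t)).mul_const (1 + CK))).add (hpG.const_mul _)).add
        ((hpG.const_mul (1 + M')).const_mul _)).add (Tendsto.const_mul β' ?_)
      exact ((hτ.const_mul _).add (hιdd.const_mul 2)).add (((hτ.mul_const _).add (hτ.mul_const _)).const_mul _)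
    simpa using h
  have hRev : ∀ᶠ N : ℕ in atTop, R N ≤ κ / 2 := (hR.eventually (eventually_le_nhds (by positivity))).mono fun N h => h
  ------------------------------------------------------------------
  -- at a fixed large `N`
  ------------------------------------------------------------------
  have hn1 : ∀ᶠ N : ℕ in atTop, 1 ≤ n N := hn.eventually_ge_atTop 1
  have hLtail := htail L hLmin
  filter_upwards [hgood, hcubic, hLtail, hepp κ₁ hκ₁0, hRev, hn1] with N hgN hcubN htailN heppN hRN hn1N
  obtain ⟨hιN, hℓ0, hℓh, hmod, hGz⟩ := hgN
  obtain ⟨hK1, hK2, hKle, hKset⟩ := hmomN N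
  haveI : IsProbabilityMeasure (P N) := hP N
  have hn0 : n N ≠ 0 := by omega
  have hint : ∀ r ∈ Set.Icc 0 t, Integrable (fun z => logProfileObs σ ρ θ u r ((Φ N).flow r z)) (P N) := fun r hr => (heppN r hr).1
  refine ⟨(hint t ⟨ht.1, le_rfl⟩), ?_⟩
  have hmeas := measurable_logProfileObs_clamp hE ht (n := n N)
  obtain ⟨hKm, hTm, hnn⟩ := measurable_kineticPP_cubicTail (n := n N) L
  have hCXb' : ∀ r ∈ Set.Icc 0 t, ∀ w : Config (n N) (Fin 3) T3, |logProfileObs σ ρ θ u r w| ≤ CX * (1 + kineticPP w) :=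
    fun r hr w => hCXb r hr w
  have hωN : 0 ≤ ((ι N : ℝ) + 1)⁻¹ := by positivity
  have hflm := measurable_fluctuationE_clamp hE ht (n := n N) (mesoRadius (n N))
  have horb : ∀ r ∈ Set.Icc 0 t, ∀ z ∈ (Φ N).good,
      IntervalIntegrable (fun r' => fluctuationE (mesoRadius (n N)) (ρ r') (θ r') (u r') ((Φ N).flow r' z)) volume 0 r ∧
      IntervalIntegrable (fun r' => cubicTail L ((Φ N).flow r' z)) volume 0 r :=
    fun r hr z hz => intervalIntegrable_fluctuationE_cubicTail_orbit hE ht (Φ N) hz le_rfl hr.1 hr.2 (mesoRadius (n N)) L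
  have hcrude : ∀ r ∈ Set.Icc 0 t, ∀ w : Config (n N) (Fin 3) T3,
      fluctuationE (mesoRadius (n N)) (ρ r) (θ r) (u r) w ≤ 2 + kineticPP w :=
    fun r _ w => fluctuationE_le hn0 hℓ0 hℓh _ _ _ w
  have hdN : 0 ≤ dd N := by simp only [hdd_def]; positivity
  have hdefW : ∀ z ∈ G' N, z ∈ (Φ N).good → packCapOn (Φ N) z (Set.Icc 0 t) (mesoRadius (n N)) σ ηP ∧
      ∀ k : ℕ, k < ι N → |momDefect σ (Φ N) z (mesoRadius (n N)) 0 ((k + 1) * (t / ι N)) (lamRow θ u)| ≤ dd N ∧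
        |enDefect σ (Φ N) z (mesoRadius (n N)) 0 ((k + 1) * (t / ι N)) (lam4Row θ)| ≤ dd N := by
    intro z hz hzg
    obtain ⟨-, hpack, hwin, -⟩ := hGz z hz hzg
    exact ⟨hpack, fun k hk => hwin k hk⟩
  have hdefC : ∀ z ∈ G' N, z ∈ (Φ N).good → packCapOn (Φ N) z (Set.Icc 0 t) (mesoRadius (n N)) σ ηP ∧
      ∀ j : ℕ, j < ι N → |momDefect σ (Φ N) z (mesoRadius (n N)) (j * (t / ι N)) (t / ι N)
          (fun r y => (j * (t / ι N) + t / ι N - r) • lamRow θ u r y)| ≤ dd N ∧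
        |enDefect σ (Φ N) z (mesoRadius (n N)) (j * (t / ι N)) (t / ι N)
          (fun r y => (j * (t / ι N) + t / ι N - r) * lam4Row θ r y)| ≤ dd N := by
    intro z hz hzg
    obtain ⟨-, hpack, -, hcell⟩ := hGz z hz hzg
    exact ⟨hpack, fun j hj => hcell j hj⟩
  have hdom : ∀ r ∈ Set.Icc 0 t, ∫ z, fluctuationE (mesoRadius (n N)) (ρ r) (θ r) (u r) ((Φ N).flow r z) ∂P N ≤
      β * (((∫ x, ρ r x * (Real.log (ρ r x) + gChem σ (ρ r x) - 3 / 2 * Real.log (2 * Real.pi * θ r x) - 3 / 2)) -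
        ∫ z, logProfileObs σ ρ θ u r ((Φ N).flow r z) ∂P N) + κ₁) := fun r hr => (heppN r hr).2.2
  -- the grid inequalities and the Grönwall step
  obtain ⟨hDint, hinc⟩ := hgi (Φ N) hn0 (P N) (hac N) hint hmeas hCX.le hCXb' hK1 hK2 hKm hℓ0 hℓh hL1 hωN hmod hflm horb hcrude hTm
    hTl0 htailN (G' N) (hG'm N) hdN hιN hdefW hβ0.le hκ₁0.le hdom
  have hcell := hgc (Φ N) hn0 (P N) (hac N) hint hmeas hCX.le hCXb' hK1 hK2 hKm hℓ0 hℓh hC3 hcubN (G' N) (hG'm N) hdN hιN hdefC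
  -- abbreviations of the `N`-dependent scalars
  set I : ℝ := ∫ z in (G' N)ᶜ, (1 + kineticPP z) ∂P N with hI_def
  set EK : ℝ := ∫ z, kineticPP z ∂P N with hEK_def
  set τN : ℝ := t / ι N with hτ_def
  set AA : ℝ := max 0 ((∫ x, ρ 0 x * (Real.log (ρ 0 x) + gChem σ (ρ 0 x) - 3 / 2 * Real.log (2 * Real.pi * θ 0 x) - 3 / 2)) -
      ∫ z, logProfileObs σ ρ θ u 0 ((Φ N).flow 0 z) ∂P N) + Cgi * (1 + L) * β * κ₁ * t + Cgi * t * Tl + 2 * dd N +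
      6 * t * ((ι N : ℝ) + 1)⁻¹ * (1 + EK) + 2 * CX * I + Cgi * t * pG N with hAA_def
  set ee : ℝ := Cgc * τN ^ 2 + 2 * dd N + Cgc * τN * (τN * (1 + EK) + τN * C3) + 2 * CX * τN * I with hee_def
  have hEK0 : 0 ≤ EK := integral_nonneg fun z => (hnn z).2
  have hI0 : 0 ≤ I := setIntegral_nonneg (hG'm N).compl fun z _ => by linarith [(hnn z).2]
  have hτ0 : 0 ≤ τN := by simp only [hτ_def]; positivity
  have hpG0 : 0 ≤ pG N := ENNReal.toReal_nonneg
  have hAA0 : 0 ≤ AA := by simp only [hAA_def]; positivity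
  have hee0 : 0 ≤ ee := by simp only [hee_def]; positivity
  have hgron := gronwall_cells (D := fun r => (∫ x, ρ r x * (Real.log (ρ r x) + gChem σ (ρ r x) -
      3 / 2 * Real.log (2 * Real.pi * θ r x) - 3 / 2)) - ∫ z, logProfileObs σ ρ θ u r ((Φ N).flow r z) ∂P N)
    (e := fun _ => ee) hιN ht0 hβ'0 hAA0 (E := (ι N : ℝ) * ee) (by positivity) hDint (fun j _ => hee0)
    (by rw [Finset.sum_const, Finset.card_range, nsmul_eq_mul]) (fun k hk => ?_) (fun j hj => ?_)
  rotate_left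
  · -- increments
    have h := hinc k hk
    simp only [hAA_def, hβ'_def, hI_def, hEK_def, hpG_def]
    simp only [hTl_def] at h ⊢
    convert h using 2
  · -- cells
    have h := hcell j hj
    simp only [hee_def, hτ_def, hI_def, hEK_def]
    convert h using 2
  ------------------------------------------------------------------
  -- the final bookkeeping
  ------------------------------------------------------------------
  have hD : H t - ∫ z, logProfileObs σ ρ θ u t ((Φ N).flow t z) ∂P N ≤ (AA + β' * ((ι N : ℝ) * ee)) * X := by
    simpa only [hH_def, hX_def] using hgron
  have hIle : I ≤ (1 + M') * pG N + CK / M' := hKset _ (hG'm N).compl M' hM'0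
  have hιτ : (ι N : ℝ) * τN = t := by
    have : (ι N : ℝ) ≠ 0 := by exact_mod_cast hιN.ne'
    rw [hτ_def]; field_simp
  have eD0 : max 0 ((∫ x, ρ 0 x * (Real.log (ρ 0 x) + gChem σ (ρ 0 x) - 3 / 2 * Real.log (2 * Real.pi * θ 0 x) - 3 / 2)) -
      ∫ z, logProfileObs σ ρ θ u 0 ((Φ N).flow 0 z) ∂P N) = D0 N := by simp only [hD0_def, hH_def]
  set J : ℝ := (1 + M') * pG N + CK / M' with hJ_def
  set AAu : ℝ := D0 N + Cgi * (1 + L) * β * κ₁ * t + Cgi * t * Tl + 2 * dd N + 6 * t * ((ι N : ℝ) + 1)⁻¹ * (1 + CK) +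
      2 * CX * J + Cgi * t * pG N with hAAu_def
  set EEu : ℝ := Cgc * t * τN + 2 * ((ι N : ℝ) * dd N) + Cgc * t * (τN * (1 + CK) + τN * C3) + 2 * CX * t * J with hEEu_def
  have hAAle : AA ≤ AAu := by
    rw [hAA_def, eD0, hAAu_def]
    have h1 : 6 * t * ((ι N : ℝ) + 1)⁻¹ * (1 + EK) ≤ 6 * t * ((ι N : ℝ) + 1)⁻¹ * (1 + CK) :=
      mul_le_mul_of_nonneg_left (by linarith only [hKle]) (by positivity)
    have h2 : 2 * CX * I ≤ 2 * CX * J := mul_le_mul_of_nonneg_left hIle (by positivity)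
    linarith only [h1, h2]
  have hEEle : (ι N : ℝ) * ee ≤ EEu := by
    have hι0 : (0 : ℝ) ≤ ι N := Nat.cast_nonneg _
    have e1 : (ι N : ℝ) * ee = Cgc * ((ι N : ℝ) * τN) * τN + 2 * ((ι N : ℝ) * dd N) +
        Cgc * ((ι N : ℝ) * τN) * (τN * (1 + EK) + τN * C3) + 2 * CX * ((ι N : ℝ) * τN) * I := by rw [hee_def]; ring
    rw [e1, hιτ, hEEu_def]
    have h1' : τN * (1 + EK) ≤ τN * (1 + CK) := mul_le_mul_of_nonneg_left (by linarith only [hKle]) hτ0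
    have h1 : Cgc * t * (τN * (1 + EK) + τN * C3) ≤ Cgc * t * (τN * (1 + CK) + τN * C3) :=
      mul_le_mul_of_nonneg_left (by linarith only [h1']) (by positivity)
    have h2 : 2 * CX * t * I ≤ 2 * CX * t * J := mul_le_mul_of_nonneg_left hIle (by positivity)
    linarith only [h1, h2]
  have hkey : X * AAu + X * (β' * EEu) = R N + Cgi * (1 + L) * β * κ₁ * t * X + Cgi * t * Tl * X + cG * (CK / M') := by
    simp only [hR_def, hAAu_def, hEEu_def, hJ_def, hcG_def]
    ring
  have hfin : (AA + β' * ((ι N : ℝ) * ee)) * X ≤ κ := by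
    calc (AA + β' * ((ι N : ℝ) * ee)) * X ≤ (AAu + β' * EEu) * X := by
          refine mul_le_mul_of_nonneg_right ?_ hX0.le
          exact add_le_add hAAle (mul_le_mul_of_nonneg_left hEEle hβ'0)
      _ = X * AAu + X * (β' * EEu) := by ring
      _ = R N + Cgi * (1 + L) * β * κ₁ * t * X + Cgi * t * Tl * X + cG * (CK / M') := hkey
      _ ≤ κ / 2 + κ / 8 + κ / 8 + κ / 8 := by linarith only [hRN, hκ₁small, hLsmall', hM'small]
      _ ≤ κ := by linarith only [hκ.le]
  linarith only [hD, hfin]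

end Summit.AtomisticToContinuum.HydrodynamicLimit.Theorems.NearConstantShortTimeHL

end
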